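import Summits.NavierStokesRegularity.NavierStokesRegularity.Theorems.CoriolisHeadNoCoRotatingCoreSpinVorticity
import Summits.NavierStokesRegularity.NavierStokesRegularity.Theorems.CoriolisHeadNoCoRotatingCoreGradientBound
import Summits.NavierStokesRegularity.NavierStokesRegularity.Theorems.CoriolisHeadCounterRotatingLiouvilleSkewLiouville
import Summits.NavierStokesRegularity.NavierStokesRegularity.Theorems.CoriolisHeadCounterRotatingLiouvilleEndgame
import Literature.Analysis.FluidPDE.SignedPowers
import Literature.Analysis.FluidPDE.FlatSwirlGaugeRelabel

/-!
# Route CoriolisHead · crux `NoCoRotatingCore` (stmt-NavierStokesRegularity-22676) —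
# stub `stub_posPartMaxPrinciple`: the damped maximum principle for the spin vorticity

Support file of the registered birth skeleton of crux `NoCoRotatingCore` (theorems only;
`--supports stmt-NavierStokesRegularity-22676`; no definitions, no named facts).  It lands the
skeleton's third stub, `stub_posPartMaxPrinciple`, by name and verbatim signature, from a general
ONE-SIDED LIOUVILLE LEMMA for the skew drift–Laplace operator of the similarity variables,

  `L f = νΔf − Df[U − By + ay]`   (`ν, a > 0`, `U` bounded, `B` skew),

namely (`nonpos_of_driftOp_pos_on_pos`): if `σ ∈ C²(ℝ³)` is polynomially bounded and a STRICT
subsolution on its own positivity set — `σ(y) > 0 ⇒ (Lσ)(y) > 0` — then `σ ≤ 0` everywhere.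
Proof: the convex, nondecreasing `C²` function `φ(s) = (s₊)³` (tree: `LeiZhang2011.contDiff_two_posPart_rpow`)
turns `σ` into a genuine polynomially bounded subsolution `Θ = φ∘σ`,
`LΘ = φ'(σ) Lσ + ν φ''(σ) |∇σ|² ≥ 0` (`driftOp_comp_deriv`), so `Θ` is constant by Tsai's
Lemma 5.1 for the skew drift (`isConst_of_driftOp_nonneg_skew_of_poly`, landed with stmt-22677); a
positive constant value would make `σ` a positive constant with `Lσ = 0`, contradicting strictness.

For the stub, `σ` is the spin vorticity `ω_β = −Σₗ (B ∂ₗU)ₗ = ⟪β, curl U⟫` of a smooth bounded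
rotated Leray profile; its polynomial bound comes from the pointwise gradient bound
`‖DU(y)‖ ≤ C(1 + |y|)^N` (`rotatedProfile_poly_bound_fderiv`, file
`CoriolisHeadNoCoRotatingCoreGradientBound`).  With `stub_spinVorticityIdentity` (landed) this
leaves the skeleton's composition `NoCoRotatingCore_of` resting on the single open stub
`stub_noStrainFedCore` (the strain feed of the co-rotating core, `⟪β, DU[curl U]⟫ < 2a ω_β` on
`{ω_β > 0}`) — which carries the whole difficulty of the crux.

HONEST FRAMING. A maximum principle, nothing more: the crux `NoCoRotatingCore` (≡ bounded
rotated-profile Liouville `X`, Pineau–Vicol 2026 Conj. 1.1 in bounded all-rotation-rates form) and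
Navier–Stokes regularity are NOT proved here.

References: T.-P. Tsai, ARMA 143 (1998), Lemma 5.1 [Tsai1998]; P. G. Lemarié-Rieusset, *The
Navier–Stokes problem in the 21st century* (2016), Lemma 16.8 [LemarieRieusset2016].
-/

noncomputable section

-- the summit and its single sub-problem share the name (CONVENTIONS §1), as in every Theorems file
set_option linter.dupNamespace false

open MeasureTheory Set Function Filter Topology InnerProductSpace Metric
open scoped RealInnerProductSpace Laplacian ContDiff BigOperators
open Literature.Analysis.FluidPDE

namespace Summit.NavierStokesRegularity.NavierStokesRegularity.Theorems.CoriolisHead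

/-! ### Chain rule for the drift operator -/

section ChainRule

variable {ν a : ℝ}

/-- **Chain rule for the drift–Laplace operator**: for `σ : ℝ³ → ℝ` of class `C²` at `y` and
`φ : ℝ → ℝ` of class `C²` at `σ y`,
`L(φ∘σ)(y) = φ'(σ y) (Lσ)(y) + ν φ''(σ y) |∇σ(y)|²`, `L f = νΔf − Df[V + ay]`. -/
theorem driftOp_comp_deriv (V : EuclideanSpace ℝ (Fin 3) → EuclideanSpace ℝ (Fin 3))
    {σ : EuclideanSpace ℝ (Fin 3) → ℝ} {φ : ℝ → ℝ} {y : EuclideanSpace ℝ (Fin 3)}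
    (hσ : ContDiffAt ℝ 2 σ y) (hφ : ContDiffAt ℝ 2 φ (σ y)) :
    driftOp ν a V (fun z => φ (σ z)) y =
      deriv φ (σ y) * driftOp ν a V σ y + ν * deriv (deriv φ) (σ y) * ‖gradient σ y‖ ^ 2 := by
  unfold driftOp
  rw [laplacian_comp_deriv_of_contDiffAt hσ hφ]
  have hd : fderiv ℝ (fun z => φ (σ z)) y = deriv φ (σ y) • fderiv ℝ σ y :=
    ((hφ.differentiableAt (by norm_num)).hasDerivAt.comp_hasFDerivAt y
      (hσ.differentiableAt (by norm_num)).hasFDerivAt).fderiv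
  rw [hd, FunLike.coe_smul, Pi.smul_apply, smul_eq_mul]
  ring

end ChainRule

/-! ### One-sided Liouville lemma for the skew drift operator -/

section OneSided

variable {ν a : ℝ} {B : EuclideanSpace ℝ (Fin 3) →L[ℝ] EuclideanSpace ℝ (Fin 3)}
  {U : EuclideanSpace ℝ (Fin 3) → EuclideanSpace ℝ (Fin 3)}

/-- **One-sided Liouville lemma (damped maximum principle) for the skew drift operator.**  Let
`ν, a > 0`, `U` bounded, `B` skew, and `σ ∈ C²(ℝ³)` polynomially bounded with
`σ(y) > 0 ⇒ νΔσ(y) − Dσ(y)[U(y) − By + ay] > 0`.  Then `σ ≤ 0` everywhere.  (Apply Tsai's Lemma 5.1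
for the skew drift to the subsolution `(σ₊)³`.) [cite: Tsai1998, Lemma 5.1] -/
theorem nonpos_of_driftOp_pos_on_pos (hν : 0 < ν) (ha : 0 < a) (hB : ∀ x, ⟪B x, x⟫ = 0)
    (hU : ∃ M : ℝ, ∀ y, ‖U y‖ ≤ M) {σ : EuclideanSpace ℝ (Fin 3) → ℝ} (hσ : ContDiff ℝ 2 σ)
    (hgr : ∃ (C : ℝ) (N : ℕ), ∀ y, |σ y| ≤ C * (1 + ‖y‖) ^ N)
    (hpos : ∀ y, 0 < σ y → 0 < driftOp ν a (fun z => U z - B z) σ y) : ∀ y, σ y ≤ 0 := by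
  have h3 : (2 : ℝ) < 3 := by norm_num
  set φ : ℝ → ℝ := fun s => max s 0 ^ (3 : ℝ) with hφ
  have hφ2 : ContDiff ℝ 2 φ := LeiZhang2011.contDiff_two_posPart_rpow h3
  set Θ : EuclideanSpace ℝ (Fin 3) → ℝ := fun z => φ (σ z) with hΘ
  have hΘ2 : ContDiff ℝ 2 Θ := hφ2.comp hσ
  -- the derivatives of `φ = (·)₊³`
  have hφ' : ∀ s, deriv φ s = 3 * max s 0 ^ ((3 : ℝ) - 1) := fun s =>
    congrFun (LeiZhang2011.deriv_posPart_rpow h3) s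
  have hφ'' : ∀ s, deriv (deriv φ) s = 3 * (3 - 1) * max s 0 ^ ((3 : ℝ) - 2) := fun s =>
    congrFun (LeiZhang2011.deriv_deriv_posPart_rpow h3) s
  have hφ'0 : ∀ s, 0 ≤ deriv φ s := fun s => by
    rw [hφ']; exact mul_nonneg (by norm_num) (LeiZhang2011.posPart_rpow_nonneg s _)
  have hφ''0 : ∀ s, 0 ≤ deriv (deriv φ) s := LeiZhang2011.deriv_deriv_posPart_rpow_nonneg h3
  have hφ'z : ∀ s, s ≤ 0 → deriv φ s = 0 := fun s hs => by
    rw [hφ', LeiZhang2011.posPart_rpow_of_nonpos hs (by norm_num)]; ring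
  have hφ''z : ∀ s, s ≤ 0 → deriv (deriv φ) s = 0 := fun s hs => by
    rw [hφ'', LeiZhang2011.posPart_rpow_of_nonpos hs (by norm_num)]; ring
  -- `Θ` is a subsolution
  have hsub : ∀ y, 0 ≤ driftOp ν a (fun z => U z - B z) Θ y := by
    intro y
    rw [hΘ, driftOp_comp_deriv _ hσ.contDiffAt hφ2.contDiffAt]
    rcases lt_or_ge 0 (σ y) with h | h
    · have h1 := hpos y h
      exact add_nonneg (mul_nonneg (hφ'0 _) h1.le)
        (mul_nonneg (mul_nonneg hν.le (hφ''0 _)) (sq_nonneg _))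
    · rw [hφ'z _ h, hφ''z _ h]; simp
  -- `Θ` is polynomially bounded
  obtain ⟨C, N, hC⟩ := hgr
  have hΘval : ∀ z, Θ z = max (σ z) 0 ^ 3 := fun z => by
    rw [hΘ, hφ]; dsimp only; exact_mod_cast Real.rpow_natCast (max (σ z) 0) 3
  have hgrowth : ∀ y, |Θ y| ≤ (max C 0) ^ 3 * (1 + ‖y‖) ^ (3 * N) := by
    intro y
    have h0 : 0 ≤ max (σ y) 0 := le_max_right _ _
    have h1 : max (σ y) 0 ≤ max C 0 * (1 + ‖y‖) ^ N := by
      refine max_le ?_ (by positivity)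
      exact (le_abs_self _).trans ((hC y).trans (by gcongr; exact le_max_left _ _))
    rw [hΘval, abs_of_nonneg (pow_nonneg h0 3), pow_mul', ← mul_pow]
    exact pow_le_pow_left₀ h0 h1 3
  have hconst := isConst_of_driftOp_nonneg_skew_of_poly hν ha hB hΘ2 hsub hU hgrowth
  -- a positive value of `σ` is impossible
  intro y
  by_contra hy
  push Not at hy
  have hΘy : Θ y = σ y ^ 3 := by rw [hΘval, max_eq_left hy.le]
  have hσconst : ∀ z, σ z = σ y := by
    intro z
    have hz : max (σ z) 0 ^ 3 = σ y ^ 3 := by rw [← hΘval, ← hΘy]; exact hconst z y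
    have h0 : 0 ≤ max (σ z) 0 := le_max_right _ _
    have hzpos : 0 < max (σ z) 0 := by
      have h3pos : 0 < max (σ z) 0 ^ 3 := by rw [hz]; positivity
      rcases h0.eq_or_lt with h00 | h00
      · rw [← h00] at h3pos; norm_num at h3pos
      · exact h00
    have hz' : max (σ z) 0 = σ y := (pow_left_inj₀ h0 hy.le (by norm_num)).1 hz
    have : 0 < σ z := by
      rcases lt_or_ge 0 (σ z) with h | h
      · exact h
      · rw [max_eq_right h] at hzpos; exact absurd hzpos (lt_irrefl _)
    rw [max_eq_left this.le] at hz'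
    exact hz'
  have hσfun : σ = fun _ => σ y := funext hσconst
  have h0 : driftOp ν a (fun z => U z - B z) σ y = 0 := by
    rw [hσfun]; exact driftOp_const _ _ _
  exact absurd (hpos y hy) (by rw [h0]; exact lt_irrefl 0)

end OneSided

/-! ### The registered stub -/

/-- **Registered stub `stub_posPartMaxPrinciple`** of the skeleton of crux `NoCoRotatingCore`
(stmt-NavierStokesRegularity-22676, birth line): the DAMPED MAXIMUM PRINCIPLE for the spin vorticity.
For a smooth bounded rotated Leray profile (`ν, a > 0`, skew `B`, `U ∈ C^∞` bounded, `P ∈ C²`,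
`div U = 0`), if the spin vorticity `ω_β = −Σₗ (B ∂ₗU)ₗ = ⟪β, curl U⟫` is a strict subsolution of
`L = νΔ − D·[U − By + ay]` wherever it is positive, then `ω_β ≤ 0` everywhere.  (`ω_β` is `C²` as a
fixed component of `curl U`, and polynomially bounded by the pointwise gradient bound
`rotatedProfile_poly_bound_fderiv`; then `nonpos_of_driftOp_pos_on_pos`.) [cite: Tsai1998, Lemma 5.1] -/
theorem stub_posPartMaxPrinciple : ∀ (ν a : ℝ), 0 < ν → 0 < a → ∀ (B : EuclideanSpace ℝ (Fin 3) →L[ℝ] EuclideanSpace ℝ (Fin 3)) (U : EuclideanSpace ℝ (Fin 3) → EuclideanSpace ℝ (Fin 3)) (P : EuclideanSpace ℝ (Fin 3) → ℝ), ContDiff ℝ (⊤ : ℕ∞) U → ContDiff ℝ 2 P → (∀ x, inner ℝ (B x) x = 0) → Literature.Analysis.FluidPDE.VectorCalculus.IsDivFree U → (∀ y, -(ν • Laplacian.laplacian U y) + a • U y + a • fderiv ℝ U y y + (B (U y) - fderiv ℝ U y (B y)) + Literature.Analysis.FluidPDE.convect U U y + gradient P y = 0) → (∃ M : ℝ, ∀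 y, ‖U y‖ ≤ M) → (∀ y, 0 < (fun z => -(∑ l, (B (fderiv ℝ U z (EuclideanSpace.single l 1))) l)) y → 0 < Literature.Analysis.FluidPDE.driftOp ν a (fun z => U z - B z) (fun z => -(∑ l, (B (fderiv ℝ U z (EuclideanSpace.single l 1))) l)) y) → ∀ y, (fun z => -(∑ l, (B (fderiv ℝ U z (EuclideanSpace.single l 1))) l)) y ≤ 0 := by
  intro ν a hν ha B U P hU hP hB hdiv heq hbdd hpos
  set β : EuclideanSpace ℝ (Fin 3) := (WithLp.toLp 2 ![(B (EuclideanSpace.single 1 1)) 2,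
    (B (EuclideanSpace.single 2 1)) 0, (B (EuclideanSpace.single 0 1)) 1] : EuclideanSpace ℝ (Fin 3))
    with hβ
  set σ : EuclideanSpace ℝ (Fin 3) → ℝ :=
    fun z => -(∑ l, (B (fderiv ℝ U z (EuclideanSpace.single l 1))) l) with hσdef
  -- the spin vorticity is the `β`-component of the vorticity, hence `C²`
  have hU3 : ContDiff ℝ 3 U := hU.of_le (by norm_cast)
  have hω2 : ContDiff ℝ 2 (curl U) := contDiff_curl (n := 2) (by exact_mod_cast hU3)
  have hspin : σ = fun z => ⟪β, curl U z⟫ := funext fun z => by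
    rw [curl_eq_curlCLM]; exact neg_sum_clm_apply_eq_inner_axial_curlCLM B hB _
  have hσ2 : ContDiff ℝ 2 σ := by rw [hspin]; exact contDiff_const.inner ℝ hω2
  -- and polynomially bounded, by the pointwise gradient bound
  obtain ⟨C, N, hC0, hC⟩ := rotatedProfile_poly_bound_fderiv ν a hν ha B U P hU hP hB hdiv heq hbdd
  have hgr : ∃ (C' : ℝ) (N' : ℕ), ∀ y, |σ y| ≤ C' * (1 + ‖y‖) ^ N' := by
    refine ⟨‖β‖ * (‖curlCLM‖ * C), N, fun y => ?_⟩
    rw [hspin]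
    calc |⟪β, curl U y⟫| ≤ ‖β‖ * ‖curl U y‖ := abs_real_inner_le_norm _ _
      _ ≤ ‖β‖ * (‖curlCLM‖ * ‖fderiv ℝ U y‖) := by gcongr; exact norm_curl_le U y
      _ ≤ ‖β‖ * (‖curlCLM‖ * (C * (1 + ‖y‖) ^ N)) := by gcongr; exact hC y
      _ = ‖β‖ * (‖curlCLM‖ * C) * (1 + ‖y‖) ^ N := by ring
  exact nonpos_of_driftOp_pos_on_pos hν ha hB hbdd hσ2 hgr (fun y hy => hpos y hy)


end Summit.NavierStokesRegularity.NavierStokesRegularity.Theorems.CoriolisHead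

end
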